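import Literature.AnabelianGeometry.SemiGraphs.ArithChartBranchAction
import Literature.AnabelianGeometry.SemiGraphs.TemperedEdgeLikeCommensurator
import Literature.AnabelianGeometry.SemiGraphs.TemperedThm37OfCompactInVerticialAt
import Literature.AnabelianGeometry.SemiGraphs.ArithIntersectionWithGeometricProofs
import HarnessLib

/-!
# [SemiAnbd] §5 p. 65 / Thm 5.4: LEVEL-A consequences of the branch-granular chart action (proof-only)

Mochizuki, *Semi-graphs of anabelioids*, Publ. RIMS **42** (2006) 221–322, §5: Def 5.1 (i) p. 62,
p. 65 ("`Π^temp_{𝔊,b} ⊆ Π^temp_{𝔊,v}` … may be thought of as the commensurator in `Π^temp_{𝔊,v}` of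
`Π^temp_{𝔾,b}`"), Rmk 5.3.1 p. 65, Thm 5.4 p. 66 ("the arithmetic actions on the underlying graphs … do
not switch the branches of any edge"). [cite: MochizukiSemiAnbd2006, §5, pp. 62–66]

PROOF-ONLY companion (abc-iut cell, L3 sub-DAG `plan/L3/SUBDAG-SemiAnbd-Thm54.md`, seat
abc-iut-w4-d040, pieces (c1)/(c2) of the LEVEL-A programme announced 2026-08-26; producer side =
abc-iut-w4-d053's hypothesis package `ArithChartBranchAction` = `ArithChartAction` + the one
branch-granular clause (BR) `conj_branchPair`).  No definition, no new named fact.  Over the package,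
two of the residual LEVEL-A binders of the Thm 5.4 (i)∧(ii) umbrella for the PRODUCED decomposition data
`decompositionDataOfChart R ι` (`ArithThm54OfChart.lean`) are DISCHARGED:

* `exists_branch_presentation_of_edgeLike_le_verticialAt` (§3 geometry, modulo Thm 3.7 (iii) at the
  graph, `CompactInVerticialAt 𝒢`): an edge-like `L` inside a verticial `H` at `v` is, for ANY verticial
  homomorphism `φ : Π_v → π₁^temp(𝒢)`, the `b`-branch group `x·φ(Π_b)·x⁻¹` of the presentation
  `H = x·φ(Π_v)·x⁻¹` for some branch `b` of its edge abutting to `v` and some `x`;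
* (c1) **`ArithChartBranchAction.hconjPair`** — abc-iut-w4-d029's binder `hconjPair` of
  `ArithChartAction.verticialEdgeLikeCompactAmple` (Rmk 5.3.1 first sentence at LEVEL A): over an open
  subgroup of `Π_A` acting trivially on the underlying semi-graph (Def 5.1 (i)(c), field
  `exists_open_trivial`), conjugation by a lift `g` acts on the PAIR (`ι Π^temp_{𝔾,v}`, `ι Π^temp_{𝔾,b}`)
  as conjugation by an element of `Π^temp_𝔾` — from (BR) and Prop 3.2 (verticial homomorphisms at one
  vertex are conjugate);
* (c2) **`ArithChartBranchAction.commensurator_map_le_of_edgeLike_le_verticialAt`** — H-CE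
  "`C(ι L) ≤ C(ι H)` for edge-like `L ≤ H` verticial" and hence abc-iut-w4-d053's binder `hsub`
  `C(ι Π^temp_{𝔾,b}) ≤ Π^temp_{𝔊,v}` of `commensurator_arithBrGp_inf_ker_of` (menu item hcomm_b):
  **`ArithChartBranchAction.commensurator_map_Hb_le_arithVertGpAt`** — from (BR), print's hypothesis
  "no switching of branches" for the action of `Π_A` on the underlying semi-graph (`NoBranchSwitching
  𝒢.graph.edgeOf actB`), `CompactInVerticialAt 𝒢`, and the commensurable terminality of edge-like
  subgroups (`TemperedEdgeLikeCommensurator.lean`): an element commensurating `ι L` normalises it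
  (rigidity), so by (BR) it carries the host `H` presented through the branch `b` to a host presented
  through `(aug g)·b = b` (no switching) that contains `L` as ITS `b`-branch group — which is `H` again
  (`N(φ(Π_b)) = φ(Π_b)`).

Nothing here takes a side on [IUTchIII] Cor. 3.12; typed ≠ proved for the packages themselves.
-/

namespace Literature.AnabelianGeometry.SemiGraphs

namespace ProfiniteSemiGraph

open CategoryTheory Topology
open scoped Pointwise

universe u u' u''

variable {𝒢 : ProfiniteSemiGraph.{u}}

/-! ### Folklore bookkeeping on iterated conjugates -/

/-- `x · (y · K · y⁻¹) · x⁻¹ = (x y) · K · (x y)⁻¹`. [folklore] -/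
private theorem map_conj_map_conj {Γ : Type u} [Group Γ] (K : Subgroup Γ) (y x : Γ) :
    (K.map (MulAut.conj y).toMonoidHom).map (MulAut.conj x).toMonoidHom =
      K.map (MulAut.conj (x * y)).toMonoidHom := by
  rw [Subgroup.map_map]
  congr 1
  ext z
  simp [MulAut.conj_apply, mul_assoc]

/-- The `ConjAct`-translate is the `MulAut.conj`-image. [folklore] -/
private theorem toConjAct_smul_eq_map {Γ : Type u} [Group Γ] (x : Γ) (K : Subgroup Γ) :
    ConjAct.toConjAct x • K = K.map (MulAut.conj x).toMonoidHom := rfl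

/-- If `γ_y ∘ φ = φ'` pointwise then `φ'(S) = y · φ(S) · y⁻¹` for every `S ≤ Π_v`. [folklore] -/
private theorem map_eq_map_conj_of_conj_eq {Γ Λ : Type u} [Group Γ] [Group Λ] [TopologicalSpace Γ]
    [TopologicalSpace Λ] (φ φ' : Γ →ₜ* Λ) (y : Λ) (hy : ∀ a, y * φ a * y⁻¹ = φ' a) (S : Subgroup Γ) :
    S.map φ'.toMonoidHom = (S.map φ.toMonoidHom).map (MulAut.conj y).toMonoidHom := by
  rw [Subgroup.map_map]
  congr 1
  ext a
  simp [MulAut.conj_apply, ← hy]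

/-! ### §3: presenting an edge-like subgroup inside a given verticial host through a branch -/

/-- **Presentation of an edge-like subgroup inside a verticial host, through a branch** (§3, modulo
Thm 3.7 (iii) at `𝒢`): if `L` is edge-like (edge `e`), `H` is verticial at `v`, `L ≤ H`, and
`φ : Π_v → π₁^temp(𝒢)` is ANY verticial homomorphism at `v`, then for some branch `b` of `e` abutting to
`v` and some `x ∈ π₁^temp(𝒢)`: `H = x·φ(Π_v)·x⁻¹` and `L = x·φ(Π_b)·x⁻¹`.  (The host `H ⊇ L` is one of the
two LEMMA-E hosts `gᵢ·φ_{uᵢ}(Π_{uᵢ})·gᵢ⁻¹` of `L = gᵢ·φ_{uᵢ}(Π_{bᵢ})·gᵢ⁻¹`, "precisely two"; its vertex is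
`v` by Thm 3.7 (ii); and `φ_v`, `φ` differ by an inner automorphism, Prop 3.2.)
[cite: MochizukiSemiAnbd2006, Thm 3.7 (i)–(iii), pp. 40–41] -/
theorem exists_branch_presentation_of_edgeLike_le_verticialAt (h : CompactInVerticialAt 𝒢)
    (h𝒢 : 𝒢.Thm37Hypotheses) (hG : 𝒢.graph.IsGraph) (c : TemperedPiChart 𝒢) {e : 𝒢.graph.Edge}
    {v : 𝒢.graph.Vertex} {L H : Subgroup c.G} (hL : L ∈ edgeLikeSubgroups c e)
    (hH : H ∈ verticialSubgroups c v) (hLH : L ≤ H) (φ : 𝒢.Gv v →ₜ* c.G) (hφ : IsVerticialHom c v φ) :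
    ∃ (b : 𝒢.graph.Branch) (hb : 𝒢.graph.abuts b = some v) (x : c.G), 𝒢.graph.edgeOf b = e ∧
      H = φ.toMonoidHom.range.map (MulAut.conj x).toMonoidHom ∧
      L = ((𝒢.branchSubgroup b v hb).map φ.toMonoidHom).map (MulAut.conj x).toMonoidHom := by
  classical
  have hVD := verticialDistinct_holds.{u}
  have hVI := verticialInjective_holds.{u}
  haveI := TemperedPiChart.t2Space c
  have hΦ' : ∀ w : 𝒢.graph.Vertex, ∃ ψ : 𝒢.Gv w →ₜ* c.G, IsVerticialHom c w ψ := by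
    intro w
    obtain ⟨K, ψ, hψ, -⟩ := (hVI 𝒢 h𝒢 c w).1
    exact ⟨ψ, hψ⟩
  choose Φ hΦ using hΦ'
  -- the two branches of `e`, their vertices, and the two presentations of `L`
  obtain ⟨b₁, b₂, h12, h1e, h2e, -⟩ := 𝒢.graph.two_branches e
  obtain ⟨u₁, hb₁⟩ := Option.isSome_iff_exists.mp (hG.abuts_isSome b₁)
  obtain ⟨u₂, hb₂⟩ := Option.isSome_iff_exists.mp (hG.abuts_isSome b₂)
  have hL₁ : L ∈ edgeLikeSubgroups c (𝒢.graph.edgeOf b₁) := by rw [h1e]; exact hL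
  have hL₂ : L ∈ edgeLikeSubgroups c (𝒢.graph.edgeOf b₂) := by rw [h2e]; exact hL
  obtain ⟨g₁, hLeq₁⟩ := edgeLike_eq_map_branchSubgroup c hb₁ hL₁ (Φ u₁) (hΦ u₁)
  obtain ⟨g₂, hLeq₂⟩ := edgeLike_eq_map_branchSubgroup c hb₂ hL₂ (Φ u₂) (hΦ u₂)
  set K₁ := (Φ u₁).toMonoidHom.range.map (MulAut.conj g₁).toMonoidHom with hK₁
  set K₂ := (Φ u₂).toMonoidHom.range.map (MulAut.conj g₂).toMonoidHom with hK₂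
  have hK₁m : K₁ ∈ verticialSubgroups c u₁ :=
    conj_mem_verticialSubgroups c (range_mem_verticialSubgroups c (Φ u₁) (hΦ u₁)) g₁
  have hK₂m : K₂ ∈ verticialSubgroups c u₂ :=
    conj_mem_verticialSubgroups c (range_mem_verticialSubgroups c (Φ u₂) (hΦ u₂)) g₂
  have hLK₁ : L ≤ K₁ := by rw [hLeq₁]; exact Subgroup.map_mono (Subgroup.map_le_range _ _)
  have hLK₂ : L ≤ K₂ := by rw [hLeq₂]; exact Subgroup.map_mono (Subgroup.map_le_range _ _)
  haveI := infinite_of_mem_edgeLikeSubgroups hVI h𝒢 c hL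
  have hLne : L ≠ ⊥ := fun h0 => by
    rw [h0] at this
    exact not_finite (⊥ : Subgroup c.G)
  have hKK : K₁ ≠ K₂ := by
    intro hKK
    refine h12 (branch_eq_of_hosts_eq hVD hVI h𝒢 c Φ hΦ hLne hb₁ hb₂ g₁ g₂ ?_ ?_ hKK)
    · rw [← hLeq₁]
    · rw [← hLeq₂]
  -- "precisely two": the host `H` is `K₁` or `K₂`
  have hLc : IsCompact (L : Set c.G) := isCompact_of_mem_edgeLikeSubgroups c hL
  obtain ⟨honly, -⟩ := (h h𝒢 c L hLc).2 hLne u₁ u₂ K₁ K₂ hK₁m hK₂m hKK hLK₁ hLK₂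
  -- from `H = gᵢ·φ_{uᵢ}(Π_{uᵢ})·gᵢ⁻¹`: `uᵢ = v`, and re-presentation through `φ`
  have key : ∀ {u : 𝒢.graph.Vertex} {b : 𝒢.graph.Branch} (hb : 𝒢.graph.abuts b = some u) (g : c.G),
      𝒢.graph.edgeOf b = e →
      L = ((𝒢.branchSubgroup b u hb).map (Φ u).toMonoidHom).map (MulAut.conj g).toMonoidHom →
      H = (Φ u).toMonoidHom.range.map (MulAut.conj g).toMonoidHom →
      ∃ (b : 𝒢.graph.Branch) (hb : 𝒢.graph.abuts b = some v) (x : c.G), 𝒢.graph.edgeOf b = e ∧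
        H = φ.toMonoidHom.range.map (MulAut.conj x).toMonoidHom ∧
        L = ((𝒢.branchSubgroup b v hb).map φ.toMonoidHom).map (MulAut.conj x).toMonoidHom := by
    intro u b hb g hbe hLe hHe
    -- the vertex of the host is `v` (Thm 3.7 (ii), clause 1)
    have huv : u = v := by
      by_contra huv
      have h0 := (hVD 𝒢 h𝒢 c).1 u v _ H
        (conj_mem_verticialSubgroups c (range_mem_verticialSubgroups c (Φ u) (hΦ u)) g) hH huv
      rw [← hHe, Subgroup.relIndex_self] at h0
      exact one_ne_zero h0
    subst huv
    -- `φ_u` and `φ` differ by an inner automorphism (Prop 3.2)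
    obtain ⟨y, hy⟩ : ∃ y : c.G, ∀ a, y * Φ u a * y⁻¹ = φ a := by
      obtain ⟨i⟩ := hΦ u
      obtain ⟨i'⟩ := hφ
      obtain ⟨y, hy, -⟩ := BTemp.exists_conj_of_natTrans c.isTempered (Φ u) φ (i.symm ≪≫ i').hom
      exact ⟨y, hy⟩
    have hrange : φ.toMonoidHom.range = (Φ u).toMonoidHom.range.map (MulAut.conj y).toMonoidHom :=
      range_eq_map_conj_of_conj_eq c (Φ u) φ y hy
    have hS : (𝒢.branchSubgroup b u hb).map φ.toMonoidHom =
        ((𝒢.branchSubgroup b u hb).map (Φ u).toMonoidHom).map (MulAut.conj y).toMonoidHom :=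
      map_eq_map_conj_of_conj_eq (Φ u) φ y hy _
    refine ⟨b, hb, g * y⁻¹, hbe, ?_, ?_⟩
    · rw [hrange, map_conj_map_conj, inv_mul_cancel_right]
      exact hHe
    · rw [hS, map_conj_map_conj, inv_mul_cancel_right]
      exact hLe
  rcases honly v H hH hLH with hH₁ | hH₂
  · exact key hb₁ g₁ h1e hLeq₁ hH₁
  · exact key hb₂ g₂ h2e hLeq₂ hH₂

/-! ### (c1): `hconjPair` from the branch-granular chart action -/

variable {c : TemperedPiChart 𝒢} {Gtp : Type u'} [Group Gtp] {PA : Type u''} [Group PA]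
  [TopologicalSpace PA] {ι : c.G →* Gtp} {aug : Gtp →* PA}
  {actV : PA → 𝒢.graph.Vertex → 𝒢.graph.Vertex} {actE : PA → 𝒢.graph.Edge → 𝒢.graph.Edge}
  {actB : PA → 𝒢.graph.Branch → 𝒢.graph.Branch}

/-- **(c1) `hconjPair` at LEVEL A** (the residual binder of abc-iut-w4-d029's
`ArithChartAction.verticialEdgeLikeCompactAmple`, i.e. of Rmk 5.3.1 first sentence for the produced
data), DISCHARGED over `ArithChartBranchAction`: for a branch `b` abutting to `v` there is an open
`U ≤ Π_A` (the one of Def 5.1 (i)(c) acting trivially on the underlying semi-graph) such that every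
`a ∈ U` lifts to some `g ∈ Π^temp_𝔊` whose conjugation acts on the pair (`ι Π^temp_{𝔾,v}`, `ι Π^temp_{𝔾,b}`)
as conjugation by an element `ι h`, `h ∈ Π^temp_𝔾`.  Inputs: (BR), `aug` surjective (Prop 5.2 (iv)),
`CompactInVerticialAt 𝒢` (for the presentation of `Π^temp_{𝔾,b}` inside `Π^temp_{𝔾,v}`), Prop 3.2.
[cite: MochizukiSemiAnbd2006, Rmk 5.3.1 / Def 5.1 (i), pp. 62, 65] -/
theorem ArithChartBranchAction.hconjPair (A : ArithChartBranchAction c ι aug actV actE actB)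
    (h : CompactInVerticialAt 𝒢) (h𝒢 : 𝒢.Thm37Hypotheses) (hG : 𝒢.graph.IsGraph)
    (R : ChartRepresentatives c) (hsurj : Function.Surjective aug)
    (b : 𝒢.graph.Branch) (v : 𝒢.graph.Vertex) (hb : 𝒢.graph.abuts b = some v) :
    ∃ U : Subgroup PA, IsOpen (U : Set PA) ∧ ∀ a ∈ U, ∃ g : Gtp, aug g = a ∧ ∃ h : c.G,
      conjSubgroup g ((R.Hv v).map ι) = conjSubgroup (ι h) ((R.Hv v).map ι) ∧
        conjSubgroup g ((R.Hb b).map ι) = conjSubgroup (ι h) ((R.Hb b).map ι) := by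
  obtain ⟨U, hUo, hU⟩ := A.exists_open_trivial
  refine ⟨U, hUo, fun a ha => ?_⟩
  obtain ⟨g, rfl⟩ := hsurj a
  refine ⟨g, rfl, ?_⟩
  -- present `Π^temp_{𝔾,v} = x·φ(Π_v)·x⁻¹`, `Π^temp_{𝔾,b} = x·φ(Π_{b''})·x⁻¹` through a branch `b''` of the edge of `b`
  obtain ⟨φ, hφ, -⟩ := R.Hv_mem v
  obtain ⟨b'', hb'', x, -, hHx, hLx⟩ :=
    exists_branch_presentation_of_edgeLike_le_verticialAt h h𝒢 hG c (R.Hb_mem b) (R.Hv_mem v)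
      (R.Hb_le b v hb) φ hφ
  -- (BR) at `(g, b'', φ, x)`, transported along `(aug g)·v = v`, `(aug g)·b'' = b''`
  have hv' : actV (aug g) v = v := (hU (aug g) ha).1 v
  have hb₀ : actB (aug g) b'' = b'' := (hU (aug g) ha).2.2 b''
  have hbA : 𝒢.graph.abuts (actB (aug g) b'') = some (actV (aug g) v) := A.abuts_actB (aug g) b'' v hb''
  obtain ⟨φ', hφ', x', h1, h2⟩ := A.conj_branchPair g b'' v hb'' φ hφ x hbA
  revert hbA φ' hφ' x' h1 h2
  rw [hv', hb₀]
  intro hbA φ' hφ' x' h1 h2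
  -- `φ'` and `φ` differ by an inner automorphism `γ_y` (Prop 3.2)
  obtain ⟨y, hy⟩ : ∃ y : c.G, ∀ a, y * φ a * y⁻¹ = φ' a := by
    obtain ⟨i⟩ := hφ
    obtain ⟨i'⟩ := hφ'
    obtain ⟨y, hy, -⟩ := BTemp.exists_conj_of_natTrans c.isTempered φ φ' (i.symm ≪≫ i').hom
    exact ⟨y, hy⟩
  have hrange : φ'.toMonoidHom.range = φ.toMonoidHom.range.map (MulAut.conj y).toMonoidHom :=
    range_eq_map_conj_of_conj_eq c φ φ' y hy
  have hS : (𝒢.branchSubgroup b'' v hb'').map φ'.toMonoidHom =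
      ((𝒢.branchSubgroup b'' v hb'').map φ.toMonoidHom).map (MulAut.conj y).toMonoidHom :=
    map_eq_map_conj_of_conj_eq φ φ' y hy _
  refine ⟨x' * y * x⁻¹, ?_, ?_⟩
  · rw [hHx, h1, hrange, map_conj_map_conj, ← map_conjSubgroup_eq, map_conj_map_conj,
      inv_mul_cancel_right]
  · rw [hLx, h2, hS, map_conj_map_conj, ← map_conjSubgroup_eq, map_conj_map_conj,
      inv_mul_cancel_right]

/-! ### (c2): H-CE `C(ι L) ≤ C(ι H)` from (BR) and "no switching of branches" -/

/-- **(c2) H-CE at LEVEL A**: for an edge-like `L` contained in a verticial `H` of `π₁^temp(𝒢)`, every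
element of `Π^temp_𝔊` commensurating `ι L` commensurates (indeed normalises) `ι H` — over the package
`ArithChartBranchAction`, for `ι` injective, under print's Thm 5.4 hypothesis that the action of `Π_A`
on the underlying semi-graph does not switch the branches of any edge (`NoBranchSwitching 𝒢.graph.edgeOf
actB`), and modulo Thm 3.7 (iii) at `𝒢` (`CompactInVerticialAt 𝒢`).  PROOF: `g ∈ C(ι L)` normalises
`ι L` (`conj_edgeLike` + rigidity of commensurable edge-like subgroups), so the edge of `L` is fixed by
`aug g` (Thm 3.7 (ii), edge form) and hence so is the presenting branch `b` (no switching) and its vertex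
`v`; by (BR) `g` carries the presentation (`x·φ(Π_v)·x⁻¹ = H`, `x·φ(Π_b)·x⁻¹ = L`) to a presentation
(`x'·φ'(Π_v)·x'⁻¹`, `x'·φ'(Π_b)·x'⁻¹ = L`) at the SAME branch; writing `φ' = γ_y ∘ φ`, the element
`x⁻¹x'y` normalises the edge-like `φ(Π_b)`, so lies in it (`N = id` on edge-like subgroups,
`TemperedEdgeLikeCommensurator`), whence `x'·φ'(Π_v)·x'⁻¹ = x·φ(Π_v)·x⁻¹ = H` and `g H g⁻¹ = H` through
`ι`. [cite: MochizukiSemiAnbd2006, §5 p. 65 / Thm 5.4 p. 66] -/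
theorem ArithChartBranchAction.commensurator_map_le_of_edgeLike_le_verticialAt
    (A : ArithChartBranchAction c ι aug actV actE actB) (h : CompactInVerticialAt 𝒢)
    (h𝒢 : 𝒢.Thm37Hypotheses) (hG : 𝒢.graph.IsGraph) (hι : Function.Injective ι)
    (hns : NoBranchSwitching 𝒢.graph.edgeOf actB) {e : 𝒢.graph.Edge} {v : 𝒢.graph.Vertex}
    {L H : Subgroup c.G} (hL : L ∈ edgeLikeSubgroups c e) (hH : H ∈ verticialSubgroups c v)
    (hLH : L ≤ H) :
    Subgroup.Commensurable.commensurator (L.map ι) ≤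
      Subgroup.Commensurable.commensurator (H.map ι) := by
  intro g hg
  -- Step 1: `g` normalises `ι L`, and `aug g` fixes the edge `e`
  obtain ⟨L', hL', hgL'⟩ := A.conj_edgeLike g e L hL
  have hcomm : Subgroup.Commensurable L' L := by
    rw [← commensurable_map_iff_of_injective hι, ← hgL']
    exact (Subgroup.Commensurable.commensurator_mem_iff _ g).mp hg
  have hLL' : L' = L := eq_of_commensurable_of_mem_edgeLikeSubgroupsAt h h𝒢 hG c hL' hL hcomm
  have hgL : conjSubgroup g (L.map ι) = L.map ι := by rw [hgL', hLL']
  have hee : actE (aug g) e = e := by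
    by_contra hne
    have h0 := edgeLikeDistinctAt_of_compactInVerticialAt h h𝒢 c (actE (aug g) e) e L L
      (hLL' ▸ hL') hL hne
    rw [Subgroup.relIndex_self] at h0
    exact one_ne_zero h0
  -- Step 2: present `H ⊇ L` through a branch `b` of `e` and any verticial `φ` at `v`
  obtain ⟨φ, hφ, rfl⟩ := hH
  obtain ⟨b, hb, x, hbe, hHx, hLx⟩ :=
    exists_branch_presentation_of_edgeLike_le_verticialAt h h𝒢 hG c hL
      (range_mem_verticialSubgroups c φ hφ) hLH φ hφ
  -- no switching: `(aug g)·b = b`, hence `(aug g)·v = v`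
  have hb₀ : actB (aug g) b = b := by
    refine hns (aug g) b ?_
    rw [A.edgeOf_actB, hbe, hee]
  have hbA : 𝒢.graph.abuts (actB (aug g) b) = some (actV (aug g) v) := A.abuts_actB (aug g) b v hb
  have hv' : actV (aug g) v = v := by
    have h1 := hbA
    rw [hb₀, hb] at h1
    exact (Option.some_injective _ h1).symm
  -- Step 3: (BR) at `(g, b, φ, x)`, transported along the two fixed-point equations
  obtain ⟨φ', hφ', x', h1, h2⟩ := A.conj_branchPair g b v hb φ hφ x hbA
  revert hbA φ' hφ' x' h1 h2
  rw [hv', hb₀]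
  intro hbA φ' hφ' x' h1 h2
  -- `φ' = γ_y ∘ φ` (Prop 3.2)
  obtain ⟨y, hy⟩ : ∃ y : c.G, ∀ a, y * φ a * y⁻¹ = φ' a := by
    obtain ⟨i⟩ := hφ
    obtain ⟨i'⟩ := hφ'
    obtain ⟨y, hy, -⟩ := BTemp.exists_conj_of_natTrans c.isTempered φ φ' (i.symm ≪≫ i').hom
    exact ⟨y, hy⟩
  have hrange : φ'.toMonoidHom.range = φ.toMonoidHom.range.map (MulAut.conj y).toMonoidHom :=
    range_eq_map_conj_of_conj_eq c φ φ' y hy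
  have hS : (𝒢.branchSubgroup b v hb).map φ'.toMonoidHom =
      ((𝒢.branchSubgroup b v hb).map φ.toMonoidHom).map (MulAut.conj y).toMonoidHom :=
    map_eq_map_conj_of_conj_eq φ φ' y hy _
  -- Step 4: `L = x·φ(Π_b)·x⁻¹ = (x'y)·φ(Π_b)·(x'y)⁻¹`, so `x⁻¹x'y` normalises `φ(Π_b)` and lies in it
  set M : Subgroup c.G := (𝒢.branchSubgroup b v hb).map φ.toMonoidHom with hM
  have hM_edge : M ∈ edgeLikeSubgroups c e := by
    -- `M = x⁻¹ · L · x`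
    have hLM : L = M.map (MulAut.conj x).toMonoidHom := hLx
    have : M = L.map (MulAut.conj x⁻¹).toMonoidHom := by
      rw [hLM, map_conj_map_conj, inv_mul_cancel]
      ext z; simp
    rw [this]
    exact conj_mem_edgeLikeSubgroups' c hL x⁻¹
  have hL2 : L.map ι = ((M.map (MulAut.conj y).toMonoidHom).map (MulAut.conj x').toMonoidHom).map ι := by
    rw [← hgL, hLx, h2, hS]
  have hL2' : L = M.map (MulAut.conj (x' * y)).toMonoidHom := by
    rw [← map_conj_map_conj]
    exact Subgroup.map_injective hι hL2
  have hnorm : ConjAct.toConjAct (x⁻¹ * (x' * y)) • M = M := by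
    rw [toConjAct_smul_eq_map, ← map_conj_map_conj, ← hL2', hLx, map_conj_map_conj, inv_mul_cancel]
    ext z; simp
  have hmem : x⁻¹ * (x' * y) ∈ φ.toMonoidHom.range :=
    Subgroup.map_le_range _ _ (mem_of_smul_eq_of_mem_edgeLikeSubgroupsAt h h𝒢 hG c hM_edge hnorm)
  -- Step 5: hence `x'·φ'(Π_v)·x'⁻¹ = x·φ(Π_v)·x⁻¹ = H`, i.e. `g` normalises `ι H`
  have hHH : (φ'.toMonoidHom.range.map (MulAut.conj x').toMonoidHom) =
      φ.toMonoidHom.range.map (MulAut.conj x).toMonoidHom := by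
    rw [hrange, map_conj_map_conj]
    have hxy : x' * y = x * (x⁻¹ * (x' * y)) := by group
    rw [hxy, ← map_conj_map_conj, ← toConjAct_smul_eq_map (x⁻¹ * (x' * y)),
      conjAct_smul_eq_self_of_mem hmem]
  rw [Subgroup.Commensurable.commensurator_mem_iff]
  have hgH : ConjAct.toConjAct g • (φ.toMonoidHom.range.map ι) = φ.toMonoidHom.range.map ι := by
    change conjSubgroup g _ = _
    conv_lhs => rw [hHx]
    rw [h1, hHH]
    exact congrArg _ hHx.symm
  rw [hgH]

/-- **`hsub` of abc-iut-w4-d053's `commensurator_arithBrGp_inf_ker_of` (menu item hcomm_b), DISCHARGED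
at LEVEL A**: `C(ι Π^temp_{𝔾,b}) ≤ Π^temp_{𝔊,v} = C(ι Π^temp_{𝔾,v})` for the produced decomposition data and a
branch `b` abutting to `v` — over `ArithChartBranchAction`, for `ι` injective, no switching of branches,
modulo `CompactInVerticialAt 𝒢`. [cite: MochizukiSemiAnbd2006, §5 p. 65 / Thm 5.4 p. 66] -/
theorem ArithChartBranchAction.commensurator_map_Hb_le_arithVertGpAt
    (A : ArithChartBranchAction c ι aug actV actE actB) (h : CompactInVerticialAt 𝒢)
    (h𝒢 : 𝒢.Thm37Hypotheses) (hG : 𝒢.graph.IsGraph) (hι : Function.Injective ι)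
    (hns : NoBranchSwitching 𝒢.graph.edgeOf actB) (R : ChartRepresentatives c)
    {b : 𝒢.graph.Branch} {v : 𝒢.graph.Vertex} (hb : 𝒢.graph.abuts b = some v) :
    Subgroup.Commensurable.commensurator ((R.Hb b).map ι) ≤ arithVertGp R ι v :=
  A.commensurator_map_le_of_edgeLike_le_verticialAt h h𝒢 hG hι hns (R.Hb_mem b) (R.Hv_mem v)
    (R.Hb_le b v hb)

/-- **Menu item hcomm_b for the produced data at LEVEL A**: `C(Π^temp_{𝔊,b} ∩ Ker aug) = Π^temp_{𝔊,b}` for a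
branch `b` abutting to `v` — abc-iut-w4-d053's `commensurator_arithBrGp_inf_ker_of` with all three
geometric inputs discharged: `hct` (verticial subgroups are commensurably terminal), `hrel`
(`Π^temp_{𝔾,v} ∩ C(Π^temp_{𝔾,b}) = Π^temp_{𝔾,b}`, `commensurator_inf_eq_of_edgeLike_le_verticialAt`) and `hsub`
(above).  Residual: the package, `ι` injective with `Ker aug = ι(Π^temp_𝔾)` (Prop 5.2 (iv)), no
switching, `CompactInVerticialAt 𝒢`. [cite: MochizukiSemiAnbd2006, §5 p. 65] -/
theorem ArithChartBranchAction.commensurator_arithBrGp_inf_kerAt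
    (A : ArithChartBranchAction c ι aug actV actE actB) (h : CompactInVerticialAt 𝒢)
    (h𝒢 : 𝒢.Thm37Hypotheses) (hG : 𝒢.graph.IsGraph) (hι : Function.Injective ι)
    (hker : aug.ker = ι.range) (hns : NoBranchSwitching 𝒢.graph.edgeOf actB)
    (R : ChartRepresentatives c) {b : 𝒢.graph.Branch} {v : 𝒢.graph.Vertex}
    (hb : 𝒢.graph.abuts b = some v) :
    Subgroup.Commensurable.commensurator (arithBrGp R ι b ⊓ aug.ker) = arithBrGp R ι b := by
  refine commensurator_arithBrGp_inf_ker_of R hι hker hb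
    (commensurator_eq_of_mem_verticialSubgroups h𝒢 c (R.Hv_mem v)) ?_
    (A.commensurator_map_Hb_le_arithVertGpAt h h𝒢 hG hι hns R hb)
  rw [inf_comm]
  exact commensurator_inf_eq_of_edgeLike_le_verticialAt h h𝒢 hG c (R.Hb_mem b) (R.Hv_mem v)
    (R.Hb_le b v hb)

end ProfiniteSemiGraph

end Literature.AnabelianGeometry.SemiGraphs
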